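import Mathlib.Data.ZMod.Basic
import Mathlib.Data.ENat.Lattice
import Mathlib.LinearAlgebra.Matrix.Kronecker
import Literature.Computability.QuantumComplexity.ReversibleCliffordT
import HarnessLib

/-!
# The ZX-calculus `ZX_{π/4}` for Clifford+T: diagrams, rules, derivation length, BIGSUM trees

Topic `Literature/Computability/QuantumComplexity`; definition request `defn-ZXTreeRefutation`
(route QuantumAdvantage/AmplitudeProofs: it types the cruxes `ApcTreeLikeZXPHP` — tree-like
ZX+BIGSUM refutations of CNF-diagrams — and `ApcDisjunctionProperty` — lengths of BIGSUM-free
derivations of juxtaposed closed diagrams).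

## Contents

1. **Diagrams and interpretation** (Jeandel–Perdrix–Vilmart, LICS 2018, §2.1). `ZXDiagram n m`
   is the TERM syntax of JPV: generators `R_Z^{(n,m)}(kπ/4)`, `R_X^{(n,m)}(kπ/4)` (`k : ZMod 8`),
   the Hadamard box, identities `𝕀^{⊗n}` (`wires n`, `wires 0 = ` the empty diagram), the
   crossing `σ`, cup `η : 0 → 2`, cap `ε : 2 → 0`, closed under `A ⨾ B` ("`A` then `B`",
   JPV's `B ∘ A`) and `A ⊗ B` (`A` on the first wires). `ZXDiagram.interp D : Matrix (QReg m)
   (QReg n) ℂ` is the standard interpretation (`⟦Z^{(n,m)}(α)⟧ = |0^m⟩⟨0^n| + e^{iα}|1^m⟩⟨1^n|`,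
   `1 + e^{iα}` when `n = m = 0`; `⟦X⟧ = H^{⊗m}⟦Z⟧H^{⊗n}`; products / Kronecker products), with
   entries in `ℤ[ω, 1/√2]`; `scalar D` for closed `D : 0 → 0`; `size D`.
2. **The calculus** (JPV §2.2 and Fig. 1). `ZXDiagram.Rule l r`: the twelve rules of Figure 1 —
   (S1) fusion (all arities, `j ≥ 1` joining wires), (S2), (S3), (E), (B1), (B2), (K), (SUP),
   (EU), (H) (all arities), (C), (BW) — transcribed from the TikZ sources of arXiv:1705.11151v2
   (the published figure), closed under upside-down flip and colour swap as its caption states;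
   JPV's two "only topology matters" equations (snakes, symmetry of cup/cap, naturality,
   commutativity and leg-bending of the spider); and the laws of a strict symmetric monoidal
   category, implicit for diagrams on paper and explicit for terms (Selinger 2010, §3).
   `ZXStep` = one rule applied in either direction inside any context (JPV: "apply the axioms
   to sub-diagrams"); `ZXDerivation D D'` (data), `ZXDerives D D' ℓ` (in exactly `ℓ` steps),
   `zxDerivLength D D' : ℕ∞` (least `ℓ`, `⊤` if none), `ZXEquivalent` (`ZX_{π/4} ⊢ D = D'`).
   Completeness (JPV Thm 1) is the NAMED FACT `JeandelPerdrixVilmart2018_completeness`;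
   soundness is a theorem (companion file `ZXCalculusSoundness`), not assumed here.
3. **BIGSUM and tree refutations** (Kissinger–van de Wetering 2021/22, §3; Kissinger–van de
   Wetering–Vilmart 2022, §4). `Split D j k D₀ D₁`: `D₀, D₁` are `D` with one green spider
   (`j` legs, phase `kπ/4`) replaced by its `|0⋯0⟩`/`|1⋯1⟩` branches, so that
   `⟦D⟧ = 2^{-j/2}(⟦D₀⟧ + e^{ikπ/4}⟦D₁⟧)`; `ZXTree D`: binary trees rooted at a closed `D` with
   rewrite edges and BIGSUM branchings, leaves explicit scalar diagrams (`ScalarTerm`);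
   `ZXTree.value`, `size` (nodes + diagram sizes), `nodes`, `splits`; `ZXTreeRefutation D`
   (value `0`); `zxTreeRefutationSize D : ℕ∞`, `zxRewriteRefutationSize` (BIGSUM-free).
4. **Circuits** (Coecke–Duncan 2011, §3). `ofGate`, `ofCircuit : QCircuit cliffordT n →
   ZXDiagram n n` (gadgets `H ↦ H`, `S ↦ Z(π/2)`, `T ↦ Z(π/4)`, `CNOT ↦` copy–merge with the
   scalar `√2`, placed on arbitrary wires by words of adjacent crossings), `kets`, `bras`,
   `amplitudeDiagram C : ZXDiagram 0 0` (the closed diagram of `⟨0…0|U_C|0…0⟩`), and the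
   juxtaposition law `scalar (D₁ ⊗ D₂) = scalar D₁ * scalar D₂`.

## Faithfulness of the encoding

Derivation LENGTH here counts structural steps (wire bending, sliding) as rule applications,
as JPV do ("only topology matters" is derived from axioms, §2.2); one graph-rewrite of the
informal open-graph presentation costs `O(s)` structural steps on diagrams of size `s` and
conversely, so lengths and tree sizes are polynomially related to the open-graph notions
(Selinger 2010, Thm. 3.12 / coherence: terms modulo the symmetric monoidal laws are diagrams up
to isomorphism). The sum-over-paths calculi (Amy; Vilmart) were NOT chosen: the cruxes quote
ZX_{π/4} and the Kissinger–van de Wetering engines.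

## References

* E. Jeandel, S. Perdrix, R. Vilmart, *A complete axiomatisation of the ZX-calculus for
  Clifford+T quantum mechanics*, LICS 2018 (arXiv:1705.11151v2), §2 and Fig. 1, Thm. 1
  [JeandelPerdrixVilmart2018].
* A. Kissinger, J. van de Wetering, *Simulating quantum circuits with ZX-calculus reduced
  stabiliser decompositions*, Quantum Sci. Technol. 7 (2022) (arXiv:2109.01076), §3
  [KissingerWetering2021]; with R. Vilmart, *Classical simulation of quantum circuits with
  partial and graphical stabiliser decompositions*, TQC 2022 (arXiv:2202.09202), §4.
* B. Coecke, R. Duncan, *Interacting quantum observables: categorical algebra and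
  diagrammatics*, New J. Phys. 13 (2011), §3 [CoeckeDuncan2011].
* P. Selinger, *A survey of graphical languages for monoidal categories* (2010), §3–4
  [Selinger2010].

## Design notes / not here

* Registers are the tree's `QReg n = Fin n → Bool`, `hGate`, `cnot`, `QCircuit`, `cliffordT`,
  `omega` (reused, not redefined); `ℕ` subtraction only inside `cnotOnWires` under `c < t` /
  `t < c` guards; junk values (documented): `onWire`/`onWires₂` off range = identity,
  `cnotOnWires n c c = wires n`, oracle gates ↦ identity, `zxDerivLength = ⊤` and
  `zxTreeRefutationSize = ⊤` when nothing exists.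
* Not here: the soundness theorems `ZXDerives → ⟦·⟧ = ⟦·⟧`, `ZXTree.value = ⟦D⟧`,
  `⟦ofCircuit C⟧ = C.toMatrix` (companion file); the CNF ↦ circuit map (item
  ApcUnsatReduces); the dagger; red-spider splits (one colour-change step away).
-/
noncomputable section

namespace Literature.Computability.QuantumComplexity

open Literature.Computability.Cryptography
open Matrix
open scoped Kronecker

/-- **ZX-diagrams** of the `π/4` (Clifford+T) fragment with `n` inputs and `m` outputs, as
terms over the generators of Jeandel–Perdrix–Vilmart: identities `𝕀^{⊗n}` (`wires n`; `wires 0` is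
the empty diagram), the crossing `σ`, the cup `η : 0 → 2`, the cap `ε : 2 → 0`, the Hadamard box,
green spiders `Z n m k = R_Z^{(n,m)}(kπ/4)`, red spiders `X n m k = R_X^{(n,m)}(kπ/4)`, and the
two compositions. [cite: JeandelPerdrixVilmart2018, §2.1] -/
inductive ZXDiagram : ℕ → ℕ → Type
  /-- `n` parallel wires (`𝕀^{⊗n}`); `wires 0` is the empty diagram. -/
  | wires (n : ℕ) : ZXDiagram n n
  /-- The crossing `σ : 2 → 2`. -/
  | swap : ZXDiagram 2 2
  /-- The cup (Bell state) `η : 0 → 2`. -/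
  | cup : ZXDiagram 0 2
  /-- The cap (Bell effect) `ε : 2 → 0`. -/
  | cap : ZXDiagram 2 0
  /-- The Hadamard box `H : 1 → 1`. -/
  | hBox : ZXDiagram 1 1
  /-- The green spider `R_Z^{(n,m)}(kπ/4)`. -/
  | Z (n m : ℕ) (k : ZMod 8) : ZXDiagram n m
  /-- The red spider `R_X^{(n,m)}(kπ/4)`. -/
  | X (n m : ℕ) (k : ZMod 8) : ZXDiagram n m
  /-- Sequential composition: `seq A B` is `A` followed by `B` (JPV's `B ∘ A`). -/
  | seq {n m k : ℕ} (A : ZXDiagram n m) (B : ZXDiagram m k) : ZXDiagram n k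
  /-- Spatial composition: `par A B` is `A` on the first wires, `B` on the last ones. -/
  | par {n m n' m' : ℕ} (A : ZXDiagram n m) (B : ZXDiagram n' m') : ZXDiagram (n + n') (m + m')

namespace ZXDiagram

/-- `A ⨾ B`: sequential composition, `A` then `B` (arguments elaborated inside-out so that
wire counts such as `(1 + 2) + 1` and `4` are matched up to computation). -/
scoped notation:60 A:60 " ⨾ " B:61 => (ZXDiagram.seq (A :) (B :) :)
/-- `A ⊗ B`: spatial composition, `A` on the first wires. -/
scoped notation:70 A:70 " ⊗ " B:71 => (ZXDiagram.par (A :) (B :) :)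

variable {n m k n' m' : ℕ}

/-! ### Size -/

/-- The size of a ZX-term: total number of spider legs plus spiders, boxes and wires
(polynomially related to the number of vertices and edges of the underlying open graph).
[folklore] -/
def size : {n m : ℕ} → ZXDiagram n m → ℕ
  | _, _, wires n => n
  | _, _, swap => 2
  | _, _, cup => 1
  | _, _, cap => 1
  | _, _, hBox => 1
  | _, _, .Z n m _ => n + m + 1
  | _, _, .X n m _ => n + m + 1
  | _, _, .seq A B => size A + size B
  | _, _, .par A B => size A + size B

/-! ### Registers: splitting `a + b` wires -/

/-- The first `a` wires of a register of `a + b` wires. [folklore] -/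
def fst {a b : ℕ} (z : QReg (a + b)) : QReg a := fun i => z (Fin.castAdd b i)

/-- The last `b` wires of a register of `a + b` wires. [folklore] -/
def snd {a b : ℕ} (z : QReg (a + b)) : QReg b := fun j => z (Fin.natAdd a j)

/-- The first part of an appended register. [folklore] -/
@[simp] theorem fst_append {a b : ℕ} (x : QReg a) (y : QReg b) : fst (Fin.append x y) = x :=
  funext fun i => by simp [fst]

/-- The last part of an appended register. [folklore] -/
@[simp] theorem snd_append {a b : ℕ} (x : QReg a) (y : QReg b) : snd (Fin.append x y) = y :=
  funext fun j => by simp [snd]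

/-- A register is its first part followed by its last part. [folklore] -/
theorem append_fst_snd {a b : ℕ} (z : QReg (a + b)) : Fin.append (fst z) (snd z) = z :=
  Fin.append_castAdd_natAdd

/-- `QReg (a + b) ≃ QReg a × QReg b`: a register is its first part and its last part.
[folklore] -/
def splitEquiv (a b : ℕ) : QReg (a + b) ≃ QReg a × QReg b where
  toFun z := (fst z, snd z)
  invFun p := Fin.append p.1 p.2
  left_inv z := append_fst_snd z
  right_inv p := by obtain ⟨x, y⟩ := p; simp

/-- `splitEquiv` splits (definitional). [folklore] -/
@[simp] theorem splitEquiv_apply {a b : ℕ} (z : QReg (a + b)) :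
    splitEquiv a b z = (fst z, snd z) := rfl

/-- `splitEquiv.symm` appends (definitional). [folklore] -/
@[simp] theorem splitEquiv_symm_apply {a b : ℕ} (p : QReg a × QReg b) :
    (splitEquiv a b).symm p = Fin.append p.1 p.2 := rfl

/-- Two registers agree iff their first and last parts agree. [folklore] -/
theorem eq_iff_fst_snd {a b : ℕ} (z z' : QReg (a + b)) : z = z' ↔ fst z = fst z' ∧ snd z = snd z' := by
  constructor
  · rintro rfl; exact ⟨rfl, rfl⟩
  · rintro ⟨h1, h2⟩
    rw [← append_fst_snd z, ← append_fst_snd z', h1, h2]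

/-! ### Matrices: tensor of blocks, phases, spiders, Hadamard tensors -/

/-- The Kronecker product of an operator on the first wires with an operator on the last
wires, as a matrix indexed by registers: `tens A B (y) (x) = A y₁ x₁ * B y₂ x₂`.
(Nielsen–Chuang §2.1.7.) [folklore] -/
def tens (A : Matrix (QReg m) (QReg n) ℂ) (B : Matrix (QReg m') (QReg n') ℂ) :
    Matrix (QReg (m + m')) (QReg (n + n')) ℂ :=
  Matrix.of fun y x => A (fst y) (fst x) * B (snd y) (snd x)

/-- Entries of the tensor of two blocks (definitional). [folklore] -/
@[simp] theorem tens_apply (A : Matrix (QReg m) (QReg n) ℂ) (B : Matrix (QReg m') (QReg n') ℂ)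
    (y : QReg (m + m')) (x : QReg (n + n')) :
    tens A B y x = A (fst y) (fst x) * B (snd y) (snd x) := rfl

/-- `tens` is the Kronecker product transported along `splitEquiv`. [folklore] -/
theorem tens_eq_reindex (A : Matrix (QReg m) (QReg n) ℂ) (B : Matrix (QReg m') (QReg n') ℂ) :
    tens A B = Matrix.reindex (splitEquiv m m').symm (splitEquiv n n').symm (A ⊗ₖ B) := by
  ext y x
  simp [Matrix.reindex_apply, Matrix.kroneckerMap_apply]

/-- Mixed-product property: `(A₁A₂) ⊗ (B₁B₂) = (A₁ ⊗ B₁)(A₂ ⊗ B₂)`. [folklore] -/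
theorem tens_mul_tens {p p' : ℕ} (A₁ : Matrix (QReg k) (QReg m) ℂ) (A₂ : Matrix (QReg m) (QReg n) ℂ)
    (B₁ : Matrix (QReg p') (QReg m') ℂ) (B₂ : Matrix (QReg m') (QReg p) ℂ) :
    tens (A₁ * A₂) (B₁ * B₂) = tens A₁ B₁ * tens A₂ B₂ := by
  rw [tens_eq_reindex, tens_eq_reindex, tens_eq_reindex, Matrix.mul_kronecker_mul]
  simp only [Matrix.reindex_apply]
  rw [Matrix.submatrix_mul_equiv]

/-- `1 ⊗ 1 = 1`. [folklore] -/
@[simp] theorem tens_one_one : tens (1 : Matrix (QReg m) (QReg m) ℂ) (1 : Matrix (QReg n) (QReg n) ℂ) = 1 := by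
  ext y x
  simp only [tens_apply, Matrix.one_apply, eq_iff_fst_snd y x]
  by_cases h1 : fst y = fst x <;> by_cases h2 : snd y = snd x <;> simp [h1, h2]

/-- The phase `e^{ikπ/4} = ω^k` of an angle `kπ/4`, `k : ZMod 8` (`ω = e^{iπ/4}` is the tree's
`Literature.Computability.QuantumComplexity.omega`). [folklore] -/
def phase (k : ZMod 8) : ℂ := omega ^ k.val

/-- `e^{i0} = 1`. [folklore] -/
@[simp] theorem phase_zero : phase 0 = 1 := by simp [phase]

/-- `e^{i(α+β)} = e^{iα}e^{iβ}` on `ZMod 8` (uses `ω⁸ = 1`). [folklore] -/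
theorem phase_add (a b : ZMod 8) : phase (a + b) = phase a * phase b := by
  rw [phase, phase, phase, ← pow_add, ZMod.val_add]
  conv_rhs => rw [← Nat.mod_add_div (a.val + b.val) 8, pow_add, pow_mul, omega_pow_eight, one_pow,
    mul_one]

/-- `e^{iπ} = -1`. [folklore] -/
@[simp] theorem phase_four : phase 4 = -1 := by
  rw [phase, show (4 : ZMod 8).val = 4 from rfl, omega_pow_four]

/-- `e^{iπ/2} = i`. [folklore] -/
@[simp] theorem phase_two : phase 2 = Complex.I := by
  rw [phase, show (2 : ZMod 8).val = 2 from rfl, omega_pow_two]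

/-- `e^{iπ/4} = ω`. [folklore] -/
theorem phase_one : phase 1 = omega := by
  rw [phase, show (1 : ZMod 8).val = 1 from rfl, pow_one]

/-- The matrix of the green spider `R_Z^{(n,m)}(kπ/4)`: `|0^m⟩⟨0^n| + e^{ikπ/4}|1^m⟩⟨1^n|`;
for `n = m = 0` both summands are the `1 × 1` scalars `1` and `e^{ikπ/4}`, giving JPV's
`1 + e^{iα}`. [cite: JeandelPerdrixVilmart2018, §2.1] -/
def zMat (n m : ℕ) (k : ZMod 8) : Matrix (QReg m) (QReg n) ℂ :=
  Matrix.of fun y x =>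
    (if (∀ i, x i = false) ∧ (∀ j, y j = false) then 1 else 0) +
      (if (∀ i, x i = true) ∧ (∀ j, y j = true) then phase k else 0)

/-- Entries of the green-spider matrix (definitional). [cite: JeandelPerdrixVilmart2018, §2.1] -/
theorem zMat_apply (n m : ℕ) (k : ZMod 8) (y : QReg m) (x : QReg n) :
    zMat n m k y x = (if (∀ i, x i = false) ∧ (∀ j, y j = false) then 1 else 0) +
      (if (∀ i, x i = true) ∧ (∀ j, y j = true) then phase k else 0) := rfl

/-- `H^{⊗n}` as a matrix on registers: the entrywise product of one-qubit Hadamard entries.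
[folklore] -/
def hMat (n : ℕ) : Matrix (QReg n) (QReg n) ℂ :=
  Matrix.of fun y x => ∏ i, hGate (fun _ => y i) (fun _ => x i)

/-- Entries of `H^{⊗n}` (definitional). [folklore] -/
theorem hMat_apply (y x : QReg n) : hMat n y x = ∏ i, hGate (fun _ => y i) (fun _ => x i) := rfl

/-! ### The standard interpretation -/

/-- **The standard interpretation** `⟦D⟧ : ℂ^{2^n} → ℂ^{2^m}` of a ZX-diagram `D : n → m`
(JPV18 §2.1), as a matrix with rows indexed by output registers and columns by input
registers. [cite: JeandelPerdrixVilmart2018, §2.1] -/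
def interp : {n m : ℕ} → ZXDiagram n m → Matrix (QReg m) (QReg n) ℂ
  | _, _, wires _ => 1
  | _, _, swap => Matrix.of fun y x => if y 0 = x 1 ∧ y 1 = x 0 then 1 else 0
  | _, _, cup => Matrix.of fun y _ => if y 0 = y 1 then 1 else 0
  | _, _, cap => Matrix.of fun _ x => if x 0 = x 1 then 1 else 0
  | _, _, hBox => hGate
  | _, _, .Z n m k => zMat n m k
  | _, _, .X n m k => hMat m * zMat n m k * hMat n
  | _, _, .seq A B => interp B * interp A
  | _, _, .par A B => tens (interp A) (interp B)

/-- `⟦𝕀^{⊗n}⟧ = 1`. [cite: JeandelPerdrixVilmart2018, §2.1] -/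
@[simp] theorem interp_wires : interp (ZXDiagram.wires n) = 1 := rfl
/-- `⟦A ⨾ B⟧ = ⟦B⟧⟦A⟧`. [cite: JeandelPerdrixVilmart2018, §2.1] -/
@[simp] theorem interp_seq (A : ZXDiagram n m) (B : ZXDiagram m k) : interp (A ⨾ B) = interp B * interp A := rfl
/-- `⟦A ⊗ B⟧ = ⟦A⟧ ⊗ ⟦B⟧`. [cite: JeandelPerdrixVilmart2018, §2.1] -/
@[simp] theorem interp_par (A : ZXDiagram n m) (B : ZXDiagram n' m') :
    interp (A ⊗ B) = tens (interp A) (interp B) := rfl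
/-- `⟦R_Z⟧` (definitional). [cite: JeandelPerdrixVilmart2018, §2.1] -/
@[simp] theorem interp_Z (k : ZMod 8) : interp (Z n m k) = zMat n m k := rfl
/-- `⟦R_X⟧ = H^{⊗m}⟦R_Z⟧H^{⊗n}`. [cite: JeandelPerdrixVilmart2018, §2.1] -/
@[simp] theorem interp_X (k : ZMod 8) : interp (X n m k) = hMat m * zMat n m k * hMat n := rfl
/-- `⟦H⟧ = hGate`. [cite: JeandelPerdrixVilmart2018, §2.1] -/
@[simp] theorem interp_hBox : interp hBox = hGate := rfl
/-- Entries of `⟦σ⟧`. [cite: JeandelPerdrixVilmart2018, §2.1] -/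
theorem interp_swap_apply (y x : QReg 2) :
    interp swap y x = if y 0 = x 1 ∧ y 1 = x 0 then 1 else 0 := rfl
/-- Entries of `⟦η⟧ = |00⟩ + |11⟩`. [cite: JeandelPerdrixVilmart2018, §2.1] -/
theorem interp_cup_apply (y : QReg 2) (x : QReg 0) : interp cup y x = if y 0 = y 1 then 1 else 0 := rfl
/-- Entries of `⟦ε⟧ = ⟨00| + ⟨11|`. [cite: JeandelPerdrixVilmart2018, §2.1] -/
theorem interp_cap_apply (y : QReg 0) (x : QReg 2) : interp cap y x = if x 0 = x 1 then 1 else 0 := rfl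

/-- The scalar `⟦D⟧ ∈ ℂ` denoted by a CLOSED diagram `D : 0 → 0` (the unique entry of its
`1 × 1` matrix). [cite: JeandelPerdrixVilmart2018, §2.1] -/
def scalar (D : ZXDiagram 0 0) : ℂ := interp D Fin.elim0 Fin.elim0

/-- Unfolding of `scalar`. [folklore] -/
theorem scalar_def (D : ZXDiagram 0 0) : scalar D = interp D Fin.elim0 Fin.elim0 := rfl

/-- A `1 × 1` matrix indexed by the empty register has a single entry. [folklore] -/
theorem apply_qReg_zero (M : Matrix (QReg 0) (QReg 0) ℂ) (y x : QReg 0) :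
    M y x = M Fin.elim0 Fin.elim0 := by
  rw [Subsingleton.elim y Fin.elim0, Subsingleton.elim x Fin.elim0]

/-- **Juxtaposition of closed diagrams is multiplicative**: `⟦D₁ ⊗ D₂⟧ = ⟦D₁⟧ · ⟦D₂⟧`.
(JPV18 §2.1, `⟦D₁ ⊗ D₂⟧ = ⟦D₁⟧ ⊗ ⟦D₂⟧`.) [cite: JeandelPerdrixVilmart2018, §2.1] -/
theorem scalar_par (D₁ D₂ : ZXDiagram 0 0) : scalar (D₁ ⊗ D₂) = scalar D₁ * scalar D₂ := by
  simp only [scalar, interp_par, tens_apply]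
  rw [apply_qReg_zero (interp D₁), apply_qReg_zero (interp D₂)]

/-- Sequential composition of closed diagrams is multiplicative as well. [folklore] -/
theorem scalar_seq (D₁ D₂ : ZXDiagram 0 0) : scalar (D₁ ⨾ D₂) = scalar D₁ * scalar D₂ := by
  simp only [scalar, interp_seq, Matrix.mul_apply, Fintype.sum_unique]
  rw [apply_qReg_zero (interp D₂), apply_qReg_zero (interp D₁), mul_comm]

/-- The empty diagram denotes `1`. [cite: JeandelPerdrixVilmart2018, §2.1] -/
@[simp] theorem scalar_wires : scalar (ZXDiagram.wires 0) = 1 := by simp [scalar_def]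

/-! ### Casts along equal wire counts -/

/-- Transport of a diagram along equalities of its numbers of inputs and outputs (the identity
on the underlying diagram; needed because `(a + b) + c` and `a + (b + c)` are not
definitionally equal). [folklore] -/
def cast (D : ZXDiagram n m) (hn : n = n') (hm : m = m') : ZXDiagram n' m' := hn ▸ hm ▸ D

/-- Casting along `rfl` is the identity. [folklore] -/
@[simp] theorem cast_rfl (D : ZXDiagram n m) : D.cast rfl rfl = D := rfl

/-- The interpretation of a cast is the reindexed interpretation. [folklore] -/
theorem interp_cast (D : ZXDiagram n m) (hn : n = n') (hm : m = m') :
    interp (D.cast hn hm) =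
      (interp D).submatrix (fun y => y ∘ Fin.cast hm) (fun x => x ∘ Fin.cast hn) := by
  subst hn; subst hm; rfl

/-- Casting preserves the size. [folklore] -/
@[simp] theorem size_cast (D : ZXDiagram n m) (hn : n = n') (hm : m = m') :
    (D.cast hn hm).size = D.size := by
  subst hn; subst hm; rfl

/-! ### Hadamard tensors -/

/-- `H^{⊗n}` as a diagram. [folklore] -/
def hTensor : (n : ℕ) → ZXDiagram n n
  | 0 => wires 0
  | n + 1 => hTensor n ⊗ hBox

/-- `H^{⊗0} = 1`. [folklore] -/
theorem hMat_zero_eq_one : hMat 0 = 1 := by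
  ext y x
  simp [hMat_apply, Matrix.one_apply, Subsingleton.elim y x]

/-- `H^{⊗(n+1)} = H^{⊗n} ⊗ H`. [folklore] -/
theorem hMat_succ : hMat (n + 1) = tens (hMat n) hGate := by
  ext y x
  simp only [hMat_apply, tens_apply, Fin.prod_univ_castSucc]
  congr 1

/-- `⟦hTensor n⟧ = H^{⊗n}`. [folklore] -/
@[simp] theorem interp_hTensor : (n : ℕ) → interp (hTensor n) = hMat n
  | 0 => by simp [hTensor, hMat_zero_eq_one]
  | n + 1 => by simp [hTensor, interp_hTensor n, hMat_succ]

/-- Entries of the Hadamard gate: `H b a = (-1)^{ab}/√2`. [folklore] -/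
theorem hGate_apply (y x : QReg 1) :
    hGate y x = if x 0 = true ∧ y 0 = true then -(1 / (Real.sqrt 2 : ℂ)) else 1 / (Real.sqrt 2 : ℂ) := by
  simp only [hGate, Matrix.of_apply]
  by_cases hx : x 0 = true <;> by_cases hy : y 0 = true <;> simp [hx, hy]

/-- `H² = 1` on one qubit. [folklore] -/
theorem hGate_mul_hGate : hGate * hGate = 1 := by
  have hs : (1 / (Real.sqrt 2 : ℂ)) * (1 / Real.sqrt 2) = 1 / 2 := by
    rw [div_mul_div_comm, one_mul, ← Complex.ofReal_mul,
      Real.mul_self_sqrt (by norm_num : (0:ℝ) ≤ 2)]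
    norm_num
  ext y x
  have huniv : (Finset.univ : Finset (QReg 1)) = {fun _ => false, fun _ => true} := by
    ext z
    simp only [Finset.mem_univ, Finset.mem_insert, Finset.mem_singleton, true_iff]
    rcases hz : z 0 with _ | _
    · left; funext i; rw [Subsingleton.elim i 0, hz]
    · right; funext i; rw [Subsingleton.elim i 0, hz]
  have hne : (fun _ : Fin 1 => false) ≠ (fun _ => true) := fun h => Bool.false_ne_true (congrFun h 0)
  have hxy : (y = x) ↔ (y 0 = x 0) :=
    ⟨fun h => by rw [h], fun h => funext fun i => by rw [Subsingleton.elim i 0, h]⟩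
  rw [Matrix.mul_apply, huniv, Finset.sum_pair hne, Matrix.one_apply]
  simp only [hGate_apply, hxy]
  set s : ℂ := 1 / (Real.sqrt 2 : ℂ)
  rcases hy0 : y 0 with _ | _ <;> rcases hx0 : x 0 with _ | _ <;>
    simp only [Bool.false_eq_true, Bool.true_eq_false, and_false, and_true, and_self, if_false,
      if_true]
  · linear_combination (2 : ℂ) * hs
  · ring
  · ring
  · linear_combination (2 : ℂ) * hs

/-- `H^{⊗n} H^{⊗n} = 1`. [folklore] -/
theorem hMat_mul_hMat : (n : ℕ) → hMat n * hMat n = 1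
  | 0 => by simp [hMat_zero_eq_one]
  | n + 1 => by rw [hMat_succ, ← tens_mul_tens, hMat_mul_hMat n, hGate_mul_hGate, tens_one_one]

/-- `H^{⊗(a+b)} = H^{⊗a} ⊗ H^{⊗b}`. [folklore] -/
theorem hMat_add (a b : ℕ) : hMat (a + b) = tens (hMat a) (hMat b) := by
  ext y x
  simp only [hMat_apply, tens_apply, Fin.prod_univ_add]
  rfl

/-- The Hadamard matrix is symmetric. [folklore] -/
theorem hGate_transpose : hGateᵀ = hGate := by
  ext y x
  simp only [Matrix.transpose_apply, hGate_apply, and_comm]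

/-- `H^{⊗n}` is symmetric. [folklore] -/
theorem hMat_transpose (n : ℕ) : (hMat n)ᵀ = hMat n := by
  ext y x
  simp only [Matrix.transpose_apply, hMat_apply]
  refine Finset.prod_congr rfl fun i _ => ?_
  conv_lhs => rw [← hGate_transpose]
  rfl

/-! ### Symmetries of the rule table: upside-down and colour swap -/

/-- The upside-down flip of a diagram (inputs and outputs exchanged, phases unchanged); its
interpretation is the transpose. JPV: "all of these rules also hold when flipped upside-down".
[cite: JeandelPerdrixVilmart2018, Fig. 1] -/
def transpose : {n m : ℕ} → ZXDiagram n m → ZXDiagram m n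
  | _, _, wires n => wires n
  | _, _, swap => swap
  | _, _, cup => cap
  | _, _, cap => cup
  | _, _, hBox => hBox
  | _, _, .Z n m k => .Z m n k
  | _, _, .X n m k => .X m n k
  | _, _, .seq A B => .seq (transpose B) (transpose A)
  | _, _, .par A B => .par (transpose A) (transpose B)

/-- The colour swap of a diagram (green and red spiders exchanged); its interpretation is the
conjugate by Hadamard tensors. JPV: "... or with the colours red and green swapped".
[cite: JeandelPerdrixVilmart2018, Fig. 1] -/
def colorSwap : {n m : ℕ} → ZXDiagram n m → ZXDiagram n m
  | _, _, wires n => wires n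
  | _, _, swap => swap
  | _, _, cup => cup
  | _, _, cap => cap
  | _, _, hBox => hBox
  | _, _, .Z n m k => .X n m k
  | _, _, .X n m k => .Z n m k
  | _, _, .seq A B => .seq (colorSwap A) (colorSwap B)
  | _, _, .par A B => .par (colorSwap A) (colorSwap B)

/-! ### Derived diagrams used in the rule table -/

/-- The scalar diagram `R_X^{(0,1)}(aπ/4) ⨾ R_Z^{(1,0)}(bπ/4)` (a red state plugged into a green
effect); `dumbbell 0 0` is JPV's scalar `√2` and `dumbbell a 4` the scalar `√2 e^{iaπ/4}` of
rule (K). [cite: JeandelPerdrixVilmart2018, Fig. 1] -/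
def dumbbell (a b : ZMod 8) : ZXDiagram 0 0 := X 0 1 a ⨾ Z 1 0 b

/-- The zero scalar: the legless green spider of phase `π`, `⟦Z^{(0,0)}(π)⟧ = 1 + e^{iπ} = 0`.
A BIGSUM-free refutation of a closed diagram `D` is a derivation `D ⟶* zero`.
[cite: JeandelPerdrixVilmart2018, §2.1] -/
def zero : ZXDiagram 0 0 := Z 0 0 4

/-- `⟦zero⟧ = 1 + e^{iπ} = 0`. [cite: JeandelPerdrixVilmart2018, §2.1] -/
@[simp] theorem scalar_zero : scalar zero = 0 := by
  simp [scalar_def, zero, zMat_apply]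

/-- The crossing of the last wire over the first `n` wires, `(n + 1) → (1 + n)`, built from
`σ`. [folklore] -/
def bswap1 : (n : ℕ) → ZXDiagram (n + 1) (1 + n)
  | 0 => wires 1
  | n + 1 => (wires n ⊗ swap) ⨾ (bswap1 n ⊗ wires 1)

/-- A red spider on a wire with a one-legged green spider attached as its left output
(gadget of rules (C) and (BW)). [cite: JeandelPerdrixVilmart2018, Fig. 1] -/
def xLeafL (k leaf : ZMod 8) : ZXDiagram 1 1 := X 1 2 k ⨾ (Z 1 0 leaf ⊗ wires 1)

/-- A red spider on a wire with a one-legged green spider attached as its right output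
(gadget of rule (C)). [cite: JeandelPerdrixVilmart2018, Fig. 1] -/
def xLeafR (k leaf : ZMod 8) : ZXDiagram 1 1 := X 1 2 k ⨾ (wires 1 ⊗ Z 1 0 leaf)

/-- Left-hand side of JPV's rule (C) ("commutation of controls", parametrised by three angles
`α = aπ/4, β = bπ/4, γ = gπ/4`), a diagram `3 → 1`, transcribed layer by layer from Fig. 1:
on the wires `(a, b, c)`: a green copy on `b`; `R_X(-γ)` merging `a` with the left copy while
`R_Z(β)` copies `c`; `R_X(γ)` merging the right copy of `b` with the left copy of `c`;
`R_Z(α)` merging; the red nodes `R_X(0)` (with a green `α` leaf) and `R_X(π)` (with a green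
`β` leaf); a final green merge. [cite: JeandelPerdrixVilmart2018, Fig. 1 rule (C)] -/
def cLhs (a b g : ZMod 8) : ZXDiagram 3 1 :=
  ((wires 1 ⊗ Z 1 2 0) ⊗ wires 1) ⨾ ((X 2 1 (-g) ⊗ wires 1) ⊗ Z 1 2 b) ⨾
    ((wires 1 ⊗ X 2 1 g) ⊗ wires 1) ⨾ (Z 2 1 a ⊗ wires 1) ⨾ (xLeafL 0 a ⊗ xLeafR 4 b) ⨾ Z 2 1 0

/-- Right-hand side of JPV's rule (C): the same shape with the roles of `α` and `β` and the
signs of `γ` exchanged between the outer wires. [cite: JeandelPerdrixVilmart2018, Fig. 1 rule (C)] -/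
def cRhs (a b g : ZMod 8) : ZXDiagram 3 1 :=
  ((wires 1 ⊗ Z 1 2 0) ⊗ wires 1) ⨾ ((Z 1 2 b ⊗ wires 1) ⊗ X 2 1 g) ⨾
    ((wires 1 ⊗ X 2 1 (-g)) ⊗ wires 1) ⨾ (wires 1 ⊗ Z 2 1 a) ⨾ (xLeafL 4 b ⊗ xLeafR 0 a) ⨾ Z 2 1 0

/-- The effect `R_X^{(1,2)}(kπ/4)` followed by two green `π/4` leaves (gadget of rule (BW)).
[cite: JeandelPerdrixVilmart2018, Fig. 1 rule (BW)] -/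
def bwLeaves (k : ZMod 8) : ZXDiagram 1 0 := X 1 2 k ⨾ (Z 1 0 1 ⊗ Z 1 0 1)

/-- A green phase-free spider on a wire with the gadget `bwLeaves k` attached
(rule (BW)). [cite: JeandelPerdrixVilmart2018, Fig. 1 rule (BW)] -/
def bwT (k : ZMod 8) : ZXDiagram 1 1 := Z 1 2 0 ⨾ (wires 1 ⊗ bwLeaves k)

/-- Left-hand side of JPV's rule (BW), a diagram `1 → 1`: the vertical chain
`Z(0) – X(0) – Z(-π/2) – X(0) – Z(0)` with its `π/4` leaves, transcribed from Fig. 1.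
[cite: JeandelPerdrixVilmart2018, Fig. 1 rule (BW)] -/
def bwLhs : ZXDiagram 1 1 := bwT 0 ⨾ xLeafL 0 1 ⨾ Z 1 1 (-2) ⨾ xLeafL 0 1 ⨾ bwT 0

/-- Right-hand side of JPV's rule (BW): the chain `Z(0) – X(π) – Z(π/4) – X(π/2)` with its
`π/4` leaves. [cite: JeandelPerdrixVilmart2018, Fig. 1 rule (BW)] -/
def bwRhs : ZXDiagram 1 1 := bwT 4 ⨾ xLeafL 4 1 ⨾ Z 1 1 1 ⨾ X 1 1 2

/-! ### The rule table -/

/-- **The axioms of `ZX_{π/4}`** as oriented pairs `Rule l r` (used in both directions by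
`ZXStep`). Three groups:

* the laws of a strict symmetric monoidal category on the term syntax (associativity and units
  of `⨾` and `⊗`, interchange, `𝕀^{⊗n} ⊗ 𝕀^{⊗m} = 𝕀^{⊗(n+m)}`, `σσ = 𝕀`, naturality of the
  crossing), which hold implicitly for diagrams drawn on paper (Selinger 2010, §3);
* JPV's axioms for "only topology matters" (the two bent-wire equations: snake identities,
  symmetry of cup and cap, and naturality / commutativity / leg-bending of the green spider)
  [JPV18 §2.2];
* the twelve rules of JPV's Figure 1: (S1) spider fusion (here with `j ≥ 1` connecting wires
  and all four groups of outer legs), (S2), (S3), (E), (B1), (B2), (K), (SUP), (EU), (H),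
  (C), (BW), each closed under upside-down flip (`transpose`) and colour swap (`colorSwap`)
  as stated in the caption of Fig. 1.

Scalars are exact (no "up to a scalar"): the scalar sub-diagrams of (B1), (B2), (K) are JPV's.
[cite: JeandelPerdrixVilmart2018, Fig. 1 and §2.2] -/
inductive Rule : {n m : ℕ} → ZXDiagram n m → ZXDiagram n m → Prop
  -- strict symmetric monoidal structure of terms
  | seq_assoc {n m k l : ℕ} (A : ZXDiagram n m) (B : ZXDiagram m k) (C : ZXDiagram k l) :
      Rule ((A ⨾ B) ⨾ C) (A ⨾ (B ⨾ C))
  | id_seq {n m : ℕ} (A : ZXDiagram n m) : Rule (wires n ⨾ A) A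
  | seq_id {n m : ℕ} (A : ZXDiagram n m) : Rule (A ⨾ wires m) A
  | par_assoc {n m n' m' n'' m'' : ℕ} (A : ZXDiagram n m) (B : ZXDiagram n' m')
      (C : ZXDiagram n'' m'') :
      Rule ((A ⊗ B) ⊗ C)
        ((A ⊗ (B ⊗ C)).cast (Nat.add_assoc n n' n'').symm (Nat.add_assoc m m' m'').symm)
  | empty_par {n m : ℕ} (A : ZXDiagram n m) :
      Rule (wires 0 ⊗ A) (A.cast (Nat.zero_add n).symm (Nat.zero_add m).symm)
  | par_empty {n m : ℕ} (A : ZXDiagram n m) : Rule (A ⊗ wires 0) A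
  | interchange {n m k n' m' k' : ℕ} (A : ZXDiagram n m) (B : ZXDiagram m k)
      (C : ZXDiagram n' m') (D : ZXDiagram m' k') :
      Rule ((A ⊗ C) ⨾ (B ⊗ D)) ((A ⨾ B) ⊗ (C ⨾ D))
  | id_par_id (n m : ℕ) : Rule (wires n ⊗ wires m) (wires (n + m))
  | swap_swap : Rule (swap ⨾ swap) (wires 2)
  | swap_nat {n m : ℕ} (A : ZXDiagram n m) :
      Rule ((A ⊗ wires 1) ⨾ bswap1 m) (bswap1 n ⨾ (wires 1 ⊗ A))
  -- JPV "only topology matters" (bent wires)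
  | snake_left : Rule ((wires 1 ⊗ cup) ⨾ (cap ⊗ wires 1)) (wires 1)
  | snake_right : Rule ((cup ⊗ wires 1) ⨾ (wires 1 ⊗ cap)) (wires 1)
  | cup_swap : Rule (cup ⨾ swap) cup
  | swap_cap : Rule (swap ⨾ cap) cap
  | spider_nat : Rule ((wires 1 ⊗ swap) ⨾ (swap ⊗ wires 1) ⨾ (wires 1 ⊗ Z 2 1 0)) ((Z 2 1 0 ⊗ wires 1) ⨾ swap)
  | spider_comm : Rule (swap ⨾ Z 2 1 0) (Z 2 1 0)
  | spider_bend : Rule ((cup ⊗ wires 1) ⨾ (wires 1 ⊗ Z 2 1 0)) (Z 1 2 0)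
  -- JPV Figure 1
  | fusion (n m j m' n' : ℕ) (hj : 1 ≤ j) (a b : ZMod 8) :
      Rule ((Z n (m + j) a ⊗ wires n') ⨾ ((wires m ⊗ Z (j + n') m' b).cast (Nat.add_assoc m j n').symm rfl))
        (Z (n + n') (m + m') (a + b))
  | identity : Rule (Z 1 1 0) (wires 1)
  | cup_rule : Rule (Z 0 2 0) cup
  | e_rule : Rule (Z 0 1 1 ⨾ X 1 0 (-1)) (wires 0)
  | copy : Rule (dumbbell 0 0 ⊗ (X 0 1 0 ⨾ Z 1 2 0)) (X 0 1 0 ⊗ X 0 1 0)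
  | bialgebra :
      Rule (dumbbell 0 0 ⊗ ((Z 1 2 0 ⊗ Z 1 2 0) ⨾ ((wires 1 ⊗ swap) ⊗ wires 1) ⨾ (X 2 1 0 ⊗ X 2 1 0)))
        (X 2 1 0 ⨾ Z 1 2 0)
  | pi_comm (a : ZMod 8) :
      Rule (dumbbell 0 0 ⊗ (X 1 1 a ⨾ Z 1 1 4)) (dumbbell a 4 ⊗ (Z 1 1 4 ⨾ X 1 1 (-a)))
  | supp (a : ZMod 8) : Rule ((Z 0 1 a ⊗ Z 0 1 (a + 4)) ⨾ X 2 1 0) (Z 0 2 (2 * a + 4) ⨾ X 2 1 0)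
  | euler : Rule hBox ((Z 1 1 2 ⊗ Z 0 1 (-2)) ⨾ X 2 1 0 ⨾ Z 1 1 2)
  | color (n m : ℕ) (a : ZMod 8) : Rule (hTensor n ⨾ X n m a ⨾ hTensor m) (Z n m a)
  | ctrl_comm (a b g : ZMod 8) : Rule (cLhs a b g) (cRhs a b g)
  | bw : Rule bwLhs bwRhs
  -- symmetries of the table
  | transpose {n m : ℕ} {l r : ZXDiagram n m} : Rule l r → Rule l.transpose r.transpose
  | colorSwap {n m : ℕ} {l r : ZXDiagram n m} : Rule l r → Rule l.colorSwap r.colorSwap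

end ZXDiagram

open ZXDiagram

/-! ### Rewriting: steps, derivations, lengths -/

/-- **One rewrite step of `ZX_{π/4}`**: an axiom applied in either direction to a sub-diagram,
i.e. the closure of `Rule ∪ Rule⁻¹` under the two compositions (JPV §2.2: "apply the axioms
to sub-diagrams"). [cite: JeandelPerdrixVilmart2018, §2.2] -/
inductive ZXStep : {n m : ℕ} → ZXDiagram n m → ZXDiagram n m → Prop
  | rule {n m : ℕ} {l r : ZXDiagram n m} : Rule l r → ZXStep l r
  | rule_symm {n m : ℕ} {l r : ZXDiagram n m} : Rule l r → ZXStep r l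
  | seq_left {n m k : ℕ} {A A' : ZXDiagram n m} (B : ZXDiagram m k) :
      ZXStep A A' → ZXStep (A ⨾ B) (A' ⨾ B)
  | seq_right {n m k : ℕ} (A : ZXDiagram n m) {B B' : ZXDiagram m k} :
      ZXStep B B' → ZXStep (A ⨾ B) (A ⨾ B')
  | par_left {n m n' m' : ℕ} {A A' : ZXDiagram n m} (B : ZXDiagram n' m') :
      ZXStep A A' → ZXStep (A ⊗ B) (A' ⊗ B)
  | par_right {n m n' m' : ℕ} (A : ZXDiagram n m) {B B' : ZXDiagram n' m'} :
      ZXStep B B' → ZXStep (A ⊗ B) (A ⊗ B')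

/-- Rewrite steps are symmetric (the axioms are equations). [cite: JeandelPerdrixVilmart2018, §2.2] -/
theorem ZXStep.symm {n m : ℕ} {D E : ZXDiagram n m} (h : ZXStep D E) : ZXStep E D := by
  induction h with
  | rule h => exact .rule_symm h
  | rule_symm h => exact .rule h
  | seq_left B _ ih => exact .seq_left B ih
  | seq_right A _ ih => exact .seq_right A ih
  | par_left B _ ih => exact .par_left B ih
  | par_right A _ ih => exact .par_right A ih

/-- **Derivations** `D ⟶* D'` in `ZX_{π/4}` as data: a finite sequence of rewrite steps
(a Cook–Reckhow style proof object whose length can be measured). [cite: JeandelPerdrixVilmart2018, §2.2] -/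
inductive ZXDerivation {n m : ℕ} : ZXDiagram n m → ZXDiagram n m → Type
  /-- The empty derivation. -/
  | refl (D : ZXDiagram n m) : ZXDerivation D D
  /-- A derivation followed by one more step. -/
  | tail {D E F : ZXDiagram n m} (d : ZXDerivation D E) (h : ZXStep E F) : ZXDerivation D F

namespace ZXDerivation

variable {n m : ℕ} {D E F : ZXDiagram n m}

/-- The length (number of rule applications) of a derivation. [cite: JeandelPerdrixVilmart2018, §2.2] -/
def length : {D E : ZXDiagram n m} → ZXDerivation D E → ℕ
  | _, _, .refl _ => 0
  | _, _, .tail d _ => d.length + 1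

/-- Concatenation of derivations. [folklore] -/
def trans (d : ZXDerivation D E) : {F : ZXDiagram n m} → ZXDerivation E F → ZXDerivation D F
  | _, .refl _ => d
  | _, .tail d' h => .tail (d.trans d') h

/-- The empty derivation has length `0`. [folklore] -/
@[simp] theorem length_refl (D : ZXDiagram n m) : (ZXDerivation.refl D).length = 0 := by
  simp [length]

/-- Appending a step adds one to the length. [folklore] -/
@[simp] theorem length_tail (d : ZXDerivation D E) (h : ZXStep E F) :
    (d.tail h).length = d.length + 1 := by
  simp [length]

/-- Concatenating with the empty derivation. [folklore] -/
@[simp] theorem trans_refl (d : ZXDerivation D E) : d.trans (.refl E) = d := by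
  simp [trans]

/-- Concatenation commutes with appending a step. [folklore] -/
@[simp] theorem trans_tail (d : ZXDerivation D E) {G : ZXDiagram n m} (d' : ZXDerivation E F)
    (h : ZXStep F G) : d.trans (d'.tail h) = (d.trans d').tail h := by
  simp [trans]

/-- Lengths add under concatenation. [folklore] -/
theorem length_trans (d : ZXDerivation D E) : {F : ZXDiagram n m} → (d' : ZXDerivation E F) →
    (d.trans d').length = d.length + d'.length
  | _, .refl _ => by simp
  | _, .tail d' h => by simp [length_trans d d', Nat.add_assoc]

/-- A single step as a derivation of length one. [folklore] -/
def single (h : ZXStep D E) : ZXDerivation D E := .tail (.refl D) h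

/-- A single step has length one. [folklore] -/
@[simp] theorem length_single (h : ZXStep D E) : (single h).length = 1 := by
  simp [single]

/-- Prepending a step. [folklore] -/
def cons (h : ZXStep D E) (d : ZXDerivation E F) : ZXDerivation D F := (single h).trans d

/-- Prepending a step adds one to the length. [folklore] -/
@[simp] theorem length_cons (h : ZXStep D E) (d : ZXDerivation E F) :
    (cons h d).length = d.length + 1 := by
  simp [cons, length_trans, Nat.add_comm]

/-- Reversal of a derivation (steps are symmetric), of the same length. [folklore] -/
def reverse : {D E : ZXDiagram n m} → ZXDerivation D E → ZXDerivation E D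
  | _, _, .refl D => .refl D
  | _, _, .tail d h => cons h.symm d.reverse

/-- Reversal preserves the length. [folklore] -/
@[simp] theorem length_reverse : {D E : ZXDiagram n m} → (d : ZXDerivation D E) →
    d.reverse.length = d.length
  | _, _, .refl _ => by simp [reverse]
  | _, _, .tail d h => by simp [reverse, length_reverse d]

end ZXDerivation

/-- `ZXDerives D D' ℓ`: `D` rewrites to `D'` in exactly `ℓ` applications of the rules of
`ZX_{π/4}` (JPV Fig. 1 with "only topology matters") to sub-diagrams. [cite: JeandelPerdrixVilmart2018, §2.2] -/
def ZXDerives {n m : ℕ} (D D' : ZXDiagram n m) (ℓ : ℕ) : Prop :=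
  ∃ d : ZXDerivation D D', d.length = ℓ

/-- `ZX_{π/4} ⊢ D = D'` (JPV's notation): `D` and `D'` are inter-derivable. [cite: JeandelPerdrixVilmart2018, §2.2] -/
def ZXEquivalent {n m : ℕ} (D D' : ZXDiagram n m) : Prop := ∃ ℓ, ZXDerives D D' ℓ

/-- **Derivation length** `zxDerivLength D D' : ℕ∞`: the least number of rule applications in
a derivation `D ⟶* D'`, and `⊤` if there is none. [cite: JeandelPerdrixVilmart2018, §2.2] -/
def zxDerivLength {n m : ℕ} (D D' : ZXDiagram n m) : ℕ∞ := ⨅ (ℓ : ℕ) (_ : ZXDerives D D' ℓ), (ℓ : ℕ∞)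

section derives

variable {n m : ℕ} {D E F : ZXDiagram n m} {ℓ ℓ' : ℕ}

/-- `D ⟶* D` in `0` steps. [folklore] -/
theorem ZXDerives.refl (D : ZXDiagram n m) : ZXDerives D D 0 := ⟨.refl D, by simp⟩

/-- One step is a derivation of length `1`. [folklore] -/
theorem ZXStep.derives (h : ZXStep D E) : ZXDerives D E 1 := ⟨.single h, by simp⟩

/-- Derivations compose, lengths add. [folklore] -/
theorem ZXDerives.trans (h : ZXDerives D E ℓ) (h' : ZXDerives E F ℓ') : ZXDerives D F (ℓ + ℓ') := by
  obtain ⟨d, rfl⟩ := h; obtain ⟨d', rfl⟩ := h'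
  exact ⟨d.trans d', d.length_trans d'⟩

/-- Derivability in `ℓ` steps is symmetric (the rules are equations). [cite: JeandelPerdrixVilmart2018, §2.2] -/
theorem ZXDerives.symm (h : ZXDerives D E ℓ) : ZXDerives E D ℓ := by
  obtain ⟨d, rfl⟩ := h
  exact ⟨d.reverse, d.length_reverse⟩

/-- Extending a derivation by one step. [folklore] -/
theorem ZXDerives.tail (h : ZXDerives D E ℓ) (h' : ZXStep E F) : ZXDerives D F (ℓ + 1) :=
  h.trans h'.derives

/-- The least length is attained: `zxDerivLength D D' ≤ ℓ` for every derivation of length `ℓ`. [folklore] -/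
theorem zxDerivLength_le (h : ZXDerives D E ℓ) : zxDerivLength D E ≤ ℓ :=
  iInf₂_le ℓ h

/-- No derivation: the length is `⊤`. [folklore] -/
theorem zxDerivLength_eq_top (h : ∀ ℓ, ¬ ZXDerives D E ℓ) : zxDerivLength D E = ⊤ := by
  simp [zxDerivLength, h]

/-- `zxDerivLength D D = 0`. [folklore] -/
@[simp] theorem zxDerivLength_self (D : ZXDiagram n m) : zxDerivLength D D = 0 :=
  le_antisymm (by simpa using zxDerivLength_le (ZXDerives.refl D)) zero_le

end derives

/-- NAMED FACT — **Completeness of `ZX_{π/4}` for Clifford+T** (Jeandel–Perdrix–Vilmart 2018,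
Theorem 1): two diagrams of the `π/4` fragment with the same standard interpretation are
inter-derivable with the rules of Figure 1 (together with "only topology matters"). Stated for
the term calculus of this file, whose structural rules present the free symmetric monoidal
category on the generators (Selinger 2010, Thm. 3.x), so that derivability of terms coincides
with JPV's derivability of diagrams. The converse (soundness) is a theorem proved rule by rule
from the interpretation. [cite: JeandelPerdrixVilmart2018, Theorem 1] -/
def JeandelPerdrixVilmart2018_completeness : Prop :=
  ∀ (n m : ℕ) (D₁ D₂ : ZXDiagram n m), D₁.interp = D₂.interp → ZXEquivalent D₁ D₂

/-! ### BIGSUM: splitting one spider into its two computational-basis branches -/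

namespace ZXDiagram

/-- `n` red effects `R_X^{(1,0)}(bπ/4)` side by side (`⟦·⟧ = (√2)^n ⟨c⋯c|` for `b = 4c`).
[cite: KissingerWetering2021, §3] -/
def xEffects (b : ZMod 8) : (n : ℕ) → ZXDiagram n 0
  | 0 => wires 0
  | n + 1 => xEffects b n ⊗ X 1 0 b

/-- `m` red states `R_X^{(0,1)}(bπ/4)` side by side (`⟦·⟧ = (√2)^m |c⋯c⟩` for `b = 4c`).
[cite: KissingerWetering2021, §3] -/
def xStates (b : ZMod 8) : (m : ℕ) → ZXDiagram 0 m
  | 0 => wires 0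
  | m + 1 => xStates b m ⊗ X 0 1 b

/-- The computational-basis branch `(√2)^{n+m} |c^m⟩⟨c^n|` of a spider with `n` inputs and
`m` outputs, as a diagram: all legs cut and capped with red `0`- (for `c = false`) or
`π`- (for `c = true`) spiders. A green spider is the BIGSUM of its two branches:
`⟦Z^{(n,m)}(α)⟧ = 2^{-(n+m)/2} (⟦branch false⟧ + e^{iα} ⟦branch true⟧)` — the case split
("cutting" / computational-basis decomposition of a spider) of the stabiliser-decomposition
simulators. [cite: KissingerWetering2021, §3] -/
def branch (c : Bool) (n m : ℕ) : ZXDiagram n m :=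
  xEffects (if c then 4 else 0) n ⨾ xStates (if c then 4 else 0) m

/-- **BIGSUM positions.** `Split D j k D₀ D₁`: the diagram `D` contains an occurrence of a green
spider `Z^{(n,m)}(kπ/4)` with `j = n + m` legs, and `D₀`, `D₁` are `D` with that occurrence
replaced by its `|0⋯0⟩`- and `|1⋯1⟩`-branch. The BIGSUM rule replaces `D` by the formal
linear combination `2^{-j/2}(D₀ + e^{ikπ/4} D₁)` (Kissinger–van de Wetering, §3: stabiliser
decompositions as sums of diagrams; Kissinger–van de Wetering–Vilmart, §4: partial /
cutting decompositions). Red spiders are split after one colour-change step.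
[cite: KissingerWetering2021, §3] -/
inductive Split : {n m : ℕ} → ZXDiagram n m → ℕ → ZMod 8 → ZXDiagram n m → ZXDiagram n m → Prop
  | here (n m : ℕ) (k : ZMod 8) : Split (Z n m k) (n + m) k (branch false n m) (branch true n m)
  | seq_left {n m l : ℕ} {A A₀ A₁ : ZXDiagram n m} {j : ℕ} {k : ZMod 8} (B : ZXDiagram m l) :
      Split A j k A₀ A₁ → Split (A ⨾ B) j k (A₀ ⨾ B) (A₁ ⨾ B)
  | seq_right {n m l : ℕ} (A : ZXDiagram n m) {B B₀ B₁ : ZXDiagram m l} {j : ℕ} {k : ZMod 8} :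
      Split B j k B₀ B₁ → Split (A ⨾ B) j k (A ⨾ B₀) (A ⨾ B₁)
  | par_left {n m n' m' : ℕ} {A A₀ A₁ : ZXDiagram n m} {j : ℕ} {k : ZMod 8} (B : ZXDiagram n' m') :
      Split A j k A₀ A₁ → Split (A ⊗ B) j k (A₀ ⊗ B) (A₁ ⊗ B)
  | par_right {n m n' m' : ℕ} (A : ZXDiagram n m) {B B₀ B₁ : ZXDiagram n' m'} {j : ℕ} {k : ZMod 8} :
      Split B j k B₀ B₁ → Split (A ⊗ B) j k (A ⊗ B₀) (A ⊗ B₁)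

/-- The BIGSUM coefficient `2^{-j/2}` of a split at a spider with `j` legs. [cite: KissingerWetering2021, §3] -/
def splitCoeff (j : ℕ) : ℂ := (1 / (Real.sqrt 2 : ℂ)) ^ j

/-! ### Explicit scalars (the leaves of a refutation tree) -/

/-- **Explicit scalar diagrams**: products (juxtapositions) of the elementary closed diagrams
whose value is read off syntactically — legless spiders `Z^{(0,0)}(kπ/4)`, `X^{(0,0)}(kπ/4)`
(value `1 + e^{ikπ/4}`) and green/red pairs `Z^{(0,j)}(aπ/4) ⨾ X^{(j,0)}(bπ/4)` joined by `j`
parallel wires (value `2^{-j/2}((1 + e^{ibπ/4}) + e^{iaπ/4}(1 + (-1)^j e^{ibπ/4}))`; `j = 3`,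
`a = b = 0` is JPV's diagram for `1/√2`, `j = 1` the scalars of rules (B1), (K)). Their values
generate the multiplicative monoid `{± ω^a (1+ω)^b 2^{-c/2}}` and include `0 = ⟦Z^{(0,0)}(π)⟧`.
[cite: JeandelPerdrixVilmart2018, §2.1 and §5 (scalar 1/2)] -/
inductive ScalarTerm
  /-- The empty diagram, value `1`. -/
  | one
  /-- A legless green spider `Z^{(0,0)}(kπ/4)`, value `1 + e^{ikπ/4}`. -/
  | zPhase (k : ZMod 8)
  /-- A legless red spider `X^{(0,0)}(kπ/4)`, value `1 + e^{ikπ/4}`. -/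
  | xPhase (k : ZMod 8)
  /-- A green state `Z^{(0,j)}(aπ/4)` and a red effect `X^{(j,0)}(bπ/4)` joined by `j` wires. -/
  | pair (j : ℕ) (a b : ZMod 8)
  /-- A red state `X^{(0,j)}(aπ/4)` and a green effect `Z^{(j,0)}(bπ/4)` joined by `j` wires
  (`j = 1`: the scalars `dumbbell a b` of rules (B1), (B2), (K)). -/
  | pairXZ (j : ℕ) (a b : ZMod 8)
  /-- Juxtaposition, value the product. -/
  | mul (s t : ScalarTerm)

namespace ScalarTerm

/-- The closed diagram denoted by an explicit scalar term. [cite: JeandelPerdrixVilmart2018, §2.1] -/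
def toZX : ScalarTerm → ZXDiagram 0 0
  | one => wires 0
  | zPhase k => Z 0 0 k
  | xPhase k => X 0 0 k
  | pair j a b => Z 0 j a ⨾ X j 0 b
  | pairXZ j a b => X 0 j a ⨾ Z j 0 b
  | mul s t => s.toZX ⊗ t.toZX

/-- The value of an explicit scalar term, read off syntactically. [cite: JeandelPerdrixVilmart2018, §2.1] -/
def value : ScalarTerm → ℂ
  | one => 1
  | zPhase k => 1 + phase k
  | xPhase k => 1 + phase k
  | pair j a b => splitCoeff j * ((1 + phase b) + phase a * (1 + (-1) ^ j * phase b))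
  | pairXZ j a b => splitCoeff j * ((1 + phase a) + phase b * (1 + (-1) ^ j * phase a))
  | mul s t => s.value * t.value

end ScalarTerm

end ZXDiagram

/-! ### Tree-like ZX+BIGSUM refutations -/

/-- **Tree-like ZX+BIGSUM certificates** rooted at a closed diagram `D`: a leaf is an explicit
scalar diagram; a unary node is one rewrite step of `ZX_{π/4}` (`ZXStep`); a binary node is a
BIGSUM split of one green spider of the current diagram into its two branches. The tree
computes `⟦D⟧` as an explicit `ℤ[ω, 1/2]`-combination of the values of its leaves
(`ZXTree.value`); it REFUTES `D` (certifies `⟦D⟧ = 0`) when that value is `0`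
(`ZXTreeRefutation`). This is the transcript of a Kissinger–van de Wetering type simulator
(interleaved ZX-simplification and spider/magic-state splitting) read as a tree-like proof.
[cite: KissingerWetering2021, §3] -/
inductive ZXTree : ZXDiagram 0 0 → Type
  /-- A leaf: an explicit scalar diagram. -/
  | leaf (s : ZXDiagram.ScalarTerm) : ZXTree s.toZX
  /-- A rewrite edge: one rule application, then a certificate for the result. -/
  | step {D E : ZXDiagram 0 0} (h : ZXStep D E) (t : ZXTree E) : ZXTree D
  /-- A BIGSUM branching at a green spider with `j` legs and phase `kπ/4`. -/
  | split {D D₀ D₁ : ZXDiagram 0 0} {j : ℕ} {k : ZMod 8} (h : ZXDiagram.Split D j k D₀ D₁)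
      (t₀ : ZXTree D₀) (t₁ : ZXTree D₁) : ZXTree D

namespace ZXTree

open ZXDiagram

/-- The scalar computed by a certificate: leaves evaluate syntactically, rewrite edges keep the
value, a split at a `j`-legged spider of phase `kπ/4` combines as `2^{-j/2}(v₀ + e^{ikπ/4} v₁)`.
[cite: KissingerWetering2021, §3] -/
def value : {D : ZXDiagram 0 0} → ZXTree D → ℂ
  | _, leaf s => s.value
  | _, step _ t => t.value
  | _, @split _ _ _ j k _ t₀ t₁ => splitCoeff j * (t₀.value + phase k * t₁.value)

/-- The size of a certificate: the number of nodes plus the sizes of the diagrams at the nodes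
(crux ApcTreeLikeZXPHP: "its size is the number of nodes plus diagram sizes"). [folklore] -/
def size : {D : ZXDiagram 0 0} → ZXTree D → ℕ
  | _, leaf s => 1 + s.toZX.size
  | D, step _ t => 1 + D.size + t.size
  | D, split _ t₀ t₁ => 1 + D.size + t₀.size + t₁.size

/-- The number of nodes of a certificate. [folklore] -/
def nodes : {D : ZXDiagram 0 0} → ZXTree D → ℕ
  | _, leaf _ => 1
  | _, step _ t => 1 + t.nodes
  | _, split _ t₀ t₁ => 1 + t₀.nodes + t₁.nodes

/-- The number of BIGSUM branchings of a certificate (`0` = a BIGSUM-free, purely rewriting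
certificate). [folklore] -/
def splits : {D : ZXDiagram 0 0} → ZXTree D → ℕ
  | _, leaf _ => 0
  | _, step _ t => t.splits
  | _, split _ t₀ t₁ => 1 + t₀.splits + t₁.splits

/-- A certificate has at most `size` nodes. [folklore] -/
theorem nodes_le_size : {D : ZXDiagram 0 0} → (t : ZXTree D) → t.nodes ≤ t.size
  | _, leaf _ => by simp [nodes, size]
  | _, step _ t => by have := nodes_le_size t; simp [nodes, size]; omega
  | _, split _ t₀ t₁ => by
      have := nodes_le_size t₀; have := nodes_le_size t₁; simp [nodes, size]; omega

/-- Certificates have positive size. [folklore] -/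
theorem one_le_size {D : ZXDiagram 0 0} (t : ZXTree D) : 1 ≤ t.size := by
  cases t <;> simp [size] <;> omega

end ZXTree

/-- **Tree-like ZX+BIGSUM refutations** of a closed diagram `D`: certificates whose computed
value is `0`, i.e. which certify `⟦D⟧ = Σ coefficients · ⟦leaves⟧ = 0`.
[cite: KissingerWetering2021, §3] -/
structure ZXTreeRefutation (D : ZXDiagram 0 0) where
  /-- The certificate. -/
  tree : ZXTree D
  /-- Its computed value vanishes. -/
  value_eq_zero : tree.value = 0

/-- **The least size of a tree-like ZX+BIGSUM refutation** of the closed diagram `D`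
(`⊤` if `D` has no refutation, e.g. when `⟦D⟧ ≠ 0`). [cite: KissingerWetering2021, §3] -/
def zxTreeRefutationSize (D : ZXDiagram 0 0) : ℕ∞ :=
  ⨅ R : ZXTreeRefutation D, (R.tree.size : ℕ∞)

/-- The least size of a BIGSUM-FREE (purely rewriting, `splits = 0`) tree refutation of `D`,
i.e. essentially the least length-plus-size of a derivation `D ⟶* (explicit zero scalar)`.
[cite: JeandelPerdrixVilmart2018, Theorem 1] -/
def zxRewriteRefutationSize (D : ZXDiagram 0 0) : ℕ∞ :=
  ⨅ (R : ZXTreeRefutation D) (_ : R.tree.splits = 0), (R.tree.size : ℕ∞)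

/-- The least refutation size is at most the size of any refutation. [folklore] -/
theorem zxTreeRefutationSize_le {D : ZXDiagram 0 0} (R : ZXTreeRefutation D) :
    zxTreeRefutationSize D ≤ R.tree.size :=
  iInf_le _ R

/-- Allowing BIGSUM can only shorten refutations. [folklore] -/
theorem zxTreeRefutationSize_le_zxRewriteRefutationSize (D : ZXDiagram 0 0) :
    zxTreeRefutationSize D ≤ zxRewriteRefutationSize D :=
  le_iInf₂ fun R _ => zxTreeRefutationSize_le R

/-- The one-leaf refutation of the explicit zero scalar `Z^{(0,0)}(π)` (size `2`). [folklore] -/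
def ZXTreeRefutation.ofZero : ZXTreeRefutation ZXDiagram.zero where
  tree := .leaf (.zPhase 4)
  value_eq_zero := by simp [ZXTree.value, ZXDiagram.ScalarTerm.value]

/-- The zero scalar has a refutation of size `2`. [folklore] -/
theorem zxTreeRefutationSize_zero_le : zxTreeRefutationSize ZXDiagram.zero ≤ 2 :=
  (zxTreeRefutationSize_le ZXTreeRefutation.ofZero).trans (by norm_num [ZXTreeRefutation.ofZero,
    ZXTree.size, ZXDiagram.ScalarTerm.toZX, ZXDiagram.size])

/-! ### Clifford+T circuits as ZX-diagrams -/

namespace ZXDiagram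

/-- A one-wire diagram placed on wire `p` of `n` parallel wires (the identity elsewhere; the
identity if `p ≥ n`, a junk case never met by a wire `p : Fin n`). [folklore] -/
def onWire (B : ZXDiagram 1 1) : (n p : ℕ) → ZXDiagram n n
  | 0, _ => wires 0
  | n + 1, p => if p = n then wires n ⊗ B else onWire B n p ⊗ wires 1

/-- A two-wire diagram placed on the adjacent wires `p, p + 1` of `n` parallel wires (the
identity if `p + 2 > n`, junk case). [folklore] -/
def onWires₂ (B : ZXDiagram 2 2) : (n p : ℕ) → ZXDiagram n n
  | 0, _ => wires 0
  | 1, _ => wires 1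
  | n + 2, p => if p = n then wires n ⊗ B else onWires₂ B (n + 1) p ⊗ wires 1

/-- The word of adjacent crossings `σ_c σ_{c+1} ⋯ σ_{c+s-1}` on `n` wires: it moves wire `c`
down to position `c + s` and the wires `c+1, …, c+s` up by one. [folklore] -/
def shiftDown (n : ℕ) : (c s : ℕ) → ZXDiagram n n
  | _, 0 => wires n
  | c, s + 1 => onWires₂ swap n c ⨾ shiftDown n (c + 1) s

/-- The `CNOT` gate as a ZX-diagram on two adjacent wires, control on the first: a green copy on
the control wire feeding a red merge on the target wire, with JPV's scalar `√2` so that the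
interpretation is exactly `cnot`. (Coecke–Duncan 2011, §3.2.) [cite: CoeckeDuncan2011, §3.2] -/
def cnotZX : ZXDiagram 2 2 := ((Z 1 2 0 ⊗ wires 1) ⨾ (wires 1 ⊗ X 2 1 0)) ⊗ dumbbell 0 0

/-- `CNOT` on adjacent wires with the control on the SECOND wire. [cite: CoeckeDuncan2011, §3.2] -/
def cnotZXFlip : ZXDiagram 2 2 := swap ⨾ cnotZX ⨾ swap

/-- `CNOT` with control wire `c` and target wire `t` among `n` wires: the control (resp. target)
is moved by adjacent crossings next to the other wire, the two-wire gadget is applied, and the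
crossings are undone (the reversed word is the upside-down flip). Junk (`wires n`) if `c = t`.
[cite: CoeckeDuncan2011, §3.2] -/
def cnotOnWires (n c t : ℕ) : ZXDiagram n n :=
  if c < t then
    shiftDown n c (t - 1 - c) ⨾ onWires₂ cnotZX n (t - 1) ⨾ (shiftDown n c (t - 1 - c)).transpose
  else if t < c then
    shiftDown n t (c - 1 - t) ⨾ onWires₂ cnotZXFlip n (c - 1) ⨾ (shiftDown n t (c - 1 - t)).transpose
  else wires n

/-- **The ZX-diagram of a placed Clifford+T gate**: `H ↦` the Hadamard box, `S ↦ Z(π/2)`,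
`T ↦ Z(π/4)` on their wire, `CNOT ↦ cnotOnWires`. Oracle gates have no ZX rendering and are
sent to the identity (junk; the translation is used on oracle-free circuits only).
[cite: CoeckeDuncan2011, §3] -/
def ofGate {n : ℕ} : QGate cliffordT n → ZXDiagram n n
  | .gate .H e => onWire hBox n ((show Fin 1 ↪ Fin n from e) 0)
  | .gate .S e => onWire (Z 1 1 2) n ((show Fin 1 ↪ Fin n from e) 0)
  | .gate .T e => onWire (Z 1 1 1) n ((show Fin 1 ↪ Fin n from e) 0)
  | .gate .CNOT e =>
      cnotOnWires n ((show Fin 2 ↪ Fin n from e) 0) ((show Fin 2 ↪ Fin n from e) 1)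
  | .oracle _ _ => wires n

/-- The ZX-diagram of a list of placed gates, head first. [cite: CoeckeDuncan2011, §3] -/
def ofGates {n : ℕ} : List (QGate cliffordT n) → ZXDiagram n n
  | [] => wires n
  | g :: gs => ofGate g ⨾ ofGates gs

/-- **The ZX-diagram of a Clifford+T circuit** (`⟦ofCircuit C⟧ = C.toMatrix` for oracle-free
`C`, proved in the companion file). [cite: CoeckeDuncan2011, §3] -/
def ofCircuit {n : ℕ} (C : QCircuit cliffordT n) : ZXDiagram n n := ofGates C.gates

/-- JPV's diagram for the scalar `1/√2`: a green and a red phase-free spider joined by three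
wires. [cite: JeandelPerdrixVilmart2018, §5 (interpretation of 1/2)] -/
def invSqrtTwo : ZXDiagram 0 0 := Z 0 3 0 ⨾ X 3 0 0

/-- The state `|0⟩` as a diagram: `R_X^{(0,1)}(0) = √2 |0⟩` times the scalar `1/√2`. [cite: CoeckeDuncan2011, §3] -/
def ket0 : ZXDiagram 0 1 := X 0 1 0 ⊗ invSqrtTwo

/-- The effect `⟨0|` as a diagram. [cite: CoeckeDuncan2011, §3] -/
def bra0 : ZXDiagram 1 0 := X 1 0 0 ⊗ invSqrtTwo

/-- `|0…0⟩` on `n` wires. [cite: CoeckeDuncan2011, §3] -/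
def kets : (n : ℕ) → ZXDiagram 0 n
  | 0 => wires 0
  | n + 1 => kets n ⊗ ket0

/-- `⟨0…0|` on `n` wires. [cite: CoeckeDuncan2011, §3] -/
def bras : (n : ℕ) → ZXDiagram n 0
  | 0 => wires 0
  | n + 1 => bras n ⊗ bra0

/-- **The closed diagram of the amplitude `⟨0…0|U_C|0…0⟩`** of a Clifford+T circuit `C`: the
CNF-diagram `D_F` of route AmplitudeProofs is `amplitudeDiagram C_F` for the counting circuit
`C_F` of item ApcUnsatReduces. [cite: CoeckeDuncan2011, §3] -/
def amplitudeDiagram {n : ℕ} (C : QCircuit cliffordT n) : ZXDiagram 0 0 :=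
  kets n ⨾ ofCircuit C ⨾ bras n

end ZXDiagram

end Literature.Computability.QuantumComplexity
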